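import Literature.Analysis.FluidPDE.BlowupAncientSolution
import Literature.Analysis.FluidPDE.NSBoundedMildOseenClassical
import Literature.Analysis.FluidPDE.ClassicalSolutionGlue
import Literature.Analysis.FluidPDE.SwirlMaximumPrinciple
import HarnessLib

/-!
# A KNSS blow-up limit is a classical solution on every window `(t₀, 0)`; its swirl obeys the maximum principle

Analysis/FluidPDE proof file (theorems only; no definitions, no named facts) about the tree's structure
`IsKNSSBlowupLimit` (`BlowupAncientSolution.lean`: a bounded ancient mild solution, `ν = 1`, smooth on `(−∞, 0) × ℝ³`,
`|v| ≤ 1 = sup |v|` — the object produced by the Koch–Nadirashvili–Seregin–Šverák zoom, Acta Math. 203 (2009) §6).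

* `IsKNSSBlowupLimit.exists_isClassicalNSSolutionOn_Ioo` — **on every window `(t₀, 0)`, `t₀ < 0`, a KNSS blow-up limit is a
  classical solution of the unforced Navier–Stokes system (`ν = 1`) for some smooth pressure**: KNSS 2009 §4 ("bounded mild
  solutions are smooth … and satisfy the equations in the classical sense", with the pressure given by the Riesz transforms) —
  here: the two-time duality identity of the ancient class translated to `(0, −t₀)` is the tree's duality-form mild solution
  from the bounded datum `v(t₀)` (`IsAncientMildSolution.isMildNSSolutionOn_translate`), and Fabes–Jones–Rivière's theorem for
  smooth bounded mild solutions (the tree's `classical_of_smooth_isMildNSSolutionOn_holds`, FJR 1972 Thm. 2.1) gives the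
  pressure; translate back (the argument of the tree's `IsTypeIAncientMild.exists_isClassicalNSSolutionOn_Ioo` with the bound
  `1` in place of `C/√(−t)`).
* `IsKNSSBlowupLimit.exists_isClassicalNSSolutionOn_Icc` — the same on every closed window `[s₁, s₂] ⊂ (−∞, 0)`, `s₁ < s₂`.
* `IsKNSSBlowupLimit.abs_swirl_le_of_le` — **the swirl maximum principle for the blow-up limit** (KNSS 2009 (1.9)–(1.10):
  `Γ = r v_θ` satisfies `Γₜ + v·∇Γ = ΔΓ − (2/r)∂ᵣΓ`, so `sup|Γ(t)|` does not increase): if the slices of `v` are axisymmetric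
  and `|Γ(s₁, ·)| ≤ M`, then `|Γ(s₂, ·)| ≤ M` for all `s₁ ≤ s₂ < 0` — the tree's DISCHARGED maximum principle
  `abs_swirl_le_of_classical` (Lei–Zhang 2017 (1.4)) on the translated closed window, velocity bound `1`.

## References

* G. Koch, N. Nadirashvili, G. Seregin, V. Šverák, *Liouville theorems for the Navier–Stokes equations and applications*,
  Acta Math. 203 (2009) 83–105 = arXiv:0709.3599, §4 (regularity of bounded mild solutions), (1.9)–(1.10) (the swirl
  equation and its maximum principle), §6 (the zoom). [KochNadirashviliSereginSverak2009]
* E. B. Fabes, B. F. Jones, N. M. Rivière, Arch. Rational Mech. Anal. 45 (1972) 222–240, Thm. 2.1. [FabesJonesRiviere1972]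
* Z. Lei, Q. S. Zhang, Pacific J. Math. 289 (2017) = arXiv:1505.02628, §1 (1.4). [LeiZhang2017]
-/

noncomputable section

open MeasureTheory Set Function Filter Real
open _root_.Topology
open scoped RealInnerProductSpace NNReal ENNReal ContDiff

namespace Literature.Analysis.FluidPDE

variable {v : ℝ → EuclideanSpace ℝ (Fin 3) → EuclideanSpace ℝ (Fin 3)}

/-- **A KNSS blow-up limit is a classical Navier–Stokes solution on every window `(t₀, 0)`, `t₀ < 0`** (unit viscosity,
zero force), for some smooth pressure: mild in the duality form between any two negative times + jointly smooth + bounded by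
`1` ⇒ classical (KNSS 2009 §4; Fabes–Jones–Rivière 1972 Thm. 2.1, the tree's `classical_of_smooth_isMildNSSolutionOn_holds`).
[cite: KochNadirashviliSereginSverak2009, §4 (bounded mild solutions are smooth and classical)] -/
theorem IsKNSSBlowupLimit.exists_isClassicalNSSolutionOn_Ioo (hv : IsKNSSBlowupLimit v) {t₀ : ℝ} (ht₀ : t₀ < 0) :
    ∃ p : ℝ → EuclideanSpace ℝ (Fin 3) → ℝ, IsClassicalNSSolutionOn (Ioo t₀ 0) 1 0 v p := by
  have hT : 0 < -t₀ := neg_pos.2 ht₀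
  set w : ℝ → EuclideanSpace ℝ (Fin 3) → EuclideanSpace ℝ (Fin 3) := fun t => v (t + t₀) with hw
  -- mild solution in duality form from the datum `v t₀` on `(0, -t₀)`
  have hmild : IsMildNSSolutionOn (Ioo 0 (-t₀)) 1 0 (v t₀) w :=
    (hv.isBoundedAncientMildSolution.isAncientMildSolution.isMildNSSolutionOn_translate t₀).mono Ioo_subset_Ico_self
  -- joint smoothness of the translate
  have hsmI : IsSmoothSpaceTimeOn (Iio 0) v := hv.smooth
  have hsm : IsSmoothSpaceTimeOn (Ioo 0 (-t₀)) w := by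
    refine (hsmI.comp_add_right t₀).mono fun t ht => ?_
    simp only [mem_preimage, mem_Iio]
    linarith [ht.2]
  -- uniform bound `1` on `(0, T₁)`, `T₁ < -t₀`
  have hbdd : ∀ T₁ ∈ Ioo 0 (-t₀), ∃ K : ℝ≥0∞, K < ⊤ ∧ ∀ t ∈ Ioo 0 T₁, eLpNorm (w t) ∞ volume ≤ K := by
    intro T₁ hT₁
    refine ⟨ENNReal.ofReal 1, ENNReal.ofReal_lt_top, fun t ht => ?_⟩
    rw [eLpNorm_exponent_top]
    refine eLpNormEssSup_le_of_ae_bound (Eventually.of_forall fun x => ?_)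
    have htt : t + t₀ < 0 := by linarith [ht.2, hT₁.2]
    exact hv.norm_le_one (t + t₀) htt x
  -- the datum: measurable and integrable against Gaussians (bounded by `1`)
  have hu₀m : AEStronglyMeasurable (v t₀) volume := hv.aestronglyMeasurable t₀ ht₀
  have hu₀G : ∀ a : ℝ, 0 < a →
      Integrable (fun y => UnboundedOperators.heatKernel a y * ‖v t₀ y‖) volume := by
    intro a ha
    have hK : Integrable (UnboundedOperators.heatKernel (E := EuclideanSpace ℝ (Fin 3)) a) volume :=
      UnboundedOperators.integrable_heatKernel_holds ha
    have h := hK.bdd_mul (c := 1) hu₀m.norm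
      (Eventually.of_forall fun y => by
        rw [norm_norm]; exact hv.norm_le_one t₀ ht₀ y)
    refine h.congr (Eventually.of_forall fun y => ?_)
    simp only [mul_comm]
  obtain ⟨q, hcl⟩ := classical_of_smooth_isMildNSSolutionOn_holds (EuclideanSpace ℝ (Fin 3)) one_pos hT hu₀m hu₀G hsm
    hbdd hmild
  -- translate back to `(t₀, 0)`
  refine ⟨fun t => q (t - t₀), ?_⟩
  have h1 := hcl.comp_add_right (-t₀)
  have hset : (fun t : ℝ => t + -t₀) ⁻¹' Ioo 0 (-t₀) = Ioo t₀ 0 := by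
    ext t
    simp only [mem_preimage, mem_Ioo]
    constructor
    · rintro ⟨h1, h2⟩; exact ⟨by linarith, by linarith⟩
    · rintro ⟨h1, h2⟩; exact ⟨by linarith, by linarith⟩
  rw [hset] at h1
  have hf : (fun t : ℝ => (0 : ℝ → EuclideanSpace ℝ (Fin 3) → EuclideanSpace ℝ (Fin 3)) (t + -t₀)) = 0 := by
    funext t; rfl
  have hu' : (fun t : ℝ => w (t + -t₀)) = v := by
    funext t; simp only [hw]; congr 1; ring
  have hp' : (fun t : ℝ => q (t + -t₀)) = fun t => q (t - t₀) := by
    funext t; rw [← sub_eq_add_neg]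
  rw [hf, hu', hp'] at h1
  exact h1

/-- A KNSS blow-up limit is a classical solution on every closed window `[s₁, s₂]` with `s₁ < s₂ < 0` (restriction of the
open-window statement from `(s₁ − 1, 0)`). [cite: KochNadirashviliSereginSverak2009, §4 (bounded mild solutions are smooth and classical)] -/
theorem IsKNSSBlowupLimit.exists_isClassicalNSSolutionOn_Icc (hv : IsKNSSBlowupLimit v) {s₁ s₂ : ℝ} (h12 : s₁ < s₂)
    (hs₂ : s₂ < 0) : ∃ p : ℝ → EuclideanSpace ℝ (Fin 3) → ℝ, IsClassicalNSSolutionOn (Icc s₁ s₂) 1 0 v p := by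
  obtain ⟨p, hcl⟩ := hv.exists_isClassicalNSSolutionOn_Ioo (t₀ := s₁ - 1) (by linarith)
  exact ⟨p, hcl.mono (fun t ht => ⟨by linarith [ht.1], lt_of_le_of_lt ht.2 hs₂⟩) (uniqueDiffOn_Icc h12)⟩

/-- **The swirl maximum principle for a KNSS blow-up limit** (KNSS 2009 (1.9)–(1.10): `sup |Γ(t)|` does not increase for
the swirl `Γ = r v_θ` of a bounded axisymmetric solution). If the slices of the blow-up limit are axisymmetric and
`|Γ(s₁, y)| ≤ M` for all `y`, then `|Γ(s₂, y)| ≤ M` for all `y`, whenever `s₁ ≤ s₂ < 0` — the tree's discharged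
`abs_swirl_le_of_classical` on the translated window `[0, s₂ − s₁]` with the velocity bound `1`.
[cite: KochNadirashviliSereginSverak2009, §1 (1.9)–(1.10)] -/
theorem IsKNSSBlowupLimit.abs_swirl_le_of_le (hv : IsKNSSBlowupLimit v) (hax : ∀ s < 0, IsAxisymmetric (v s))
    {s₁ s₂ M : ℝ} (h12 : s₁ ≤ s₂) (hs₂ : s₂ < 0) (hM : ∀ y, |swirl (v s₁) y| ≤ M) (y : EuclideanSpace ℝ (Fin 3)) :
    |swirl (v s₂) y| ≤ M := by
  rcases h12.eq_or_lt with heq | hlt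
  · rw [← heq]; exact hM y
  obtain ⟨p, hcl⟩ := hv.exists_isClassicalNSSolutionOn_Icc hlt hs₂
  set T : ℝ := s₂ - s₁ with hT_def
  have hT : 0 < T := by rw [hT_def]; linarith
  -- translate the closed window to `[0, T]`
  have h1 := hcl.comp_add_right s₁
  have hset : (fun t : ℝ => t + s₁) ⁻¹' Icc s₁ s₂ = Icc 0 T := by
    ext t
    simp only [mem_preimage, mem_Icc, hT_def]
    constructor
    · rintro ⟨h1, h2⟩; exact ⟨by linarith, by linarith⟩
    · rintro ⟨h1, h2⟩; exact ⟨by linarith, by linarith⟩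
  rw [hset] at h1
  have hf : (fun t : ℝ => (0 : ℝ → EuclideanSpace ℝ (Fin 3) → EuclideanSpace ℝ (Fin 3)) (t + s₁)) = 0 := by
    funext t; rfl
  rw [hf] at h1
  have haxi : ∀ t ∈ Icc 0 T, IsAxisymmetric ((fun t => v (t + s₁)) t) := fun t ht =>
    hax (t + s₁) (by rw [hT_def] at ht; linarith [ht.2])
  have hV : ∀ t ∈ Icc 0 T, ∀ x, ‖(fun t => v (t + s₁)) t x‖ ≤ 1 := fun t ht x =>
    hv.norm_le_one (t + s₁) (by rw [hT_def] at ht; linarith [ht.2]) x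
  have hM' : ∀ x, |swirl ((fun t => v (t + s₁)) 0) x| ≤ M := fun x => by simpa using hM x
  have h := abs_swirl_le_of_classical one_pos hT h1 haxi hV hM' T ⟨hT.le, le_rfl⟩ y
  have hTs : T + s₁ = s₂ := by rw [hT_def]; ring
  simpa [hTs] using h

/-- **Monotone form**: along a KNSS blow-up limit with axisymmetric slices, a swirl bound propagates forward from any past
time to every later negative time. [cite: KochNadirashviliSereginSverak2009, §1 (1.9)–(1.10)] -/
theorem IsKNSSBlowupLimit.abs_swirl_le_forward (hv : IsKNSSBlowupLimit v) (hax : ∀ s < 0, IsAxisymmetric (v s))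
    {s₁ M : ℝ} (hM : ∀ y, |swirl (v s₁) y| ≤ M) :
    ∀ s ∈ Ico s₁ 0, ∀ y, |swirl (v s) y| ≤ M := fun _ hs y =>
  hv.abs_swirl_le_of_le hax hs.1 hs.2 hM y

/-- **Contrapositive (where a later swirl value must come from)**: if `|Γ(s₂, y₀)| > m` at some negative time `s₂` then at
EVERY earlier time `s₁ ≤ s₂` some point carries `|Γ(s₁, y)| > m`. [cite: KochNadirashviliSereginSverak2009, §1 (1.9)–(1.10)] -/
theorem IsKNSSBlowupLimit.exists_lt_abs_swirl_of_lt (hv : IsKNSSBlowupLimit v) (hax : ∀ s < 0, IsAxisymmetric (v s))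
    {s₁ s₂ m : ℝ} (h12 : s₁ ≤ s₂) (hs₂ : s₂ < 0) {y₀ : EuclideanSpace ℝ (Fin 3)} (hm : m < |swirl (v s₂) y₀|) :
    ∃ y : EuclideanSpace ℝ (Fin 3), m < |swirl (v s₁) y| := by
  by_contra h
  simp only [not_exists, not_lt] at h
  exact absurd (hv.abs_swirl_le_of_le hax h12 hs₂ h y₀) (not_le.2 hm)

end Literature.Analysis.FluidPDE
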